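import Summits.MatrixMultiplication.OmegaCensus.STPP222SqSearch

/-!
# ω-census, the pattern `(2,2,2)²`: code structures and the reflection theorem for the kernel search

HONEST FRAMING (pub-omega census; verbatim): lottery ticket; floor = certified bounds/negative ranges.
Census STRUCTURE bookkeeping (question Q7, row `k = 2`: the lower halves `n₂ ≥ 24`, `N₂ ≥ 26`), not progress on `ω`.

Companion of `STPP222SqSearch.lean` (the Boolean search `searchB` over integer codes).  Here:
* CODE STRUCTURES `Enc G C` (an injective `enc : G → C` intertwining `-`, `+`, `0` with code operations, and a key
  numbering), with the instances `zmodEnc n` (`ZMod.val`) and `prodEnc` (componentwise, mixed-radix key);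
* the REFLECTION THEOREM `nf_false_of_searchB`: if `searchB … reps = true` then no STPP configuration over `G` in normal
  form (membership version: `0, a ∈ A 0`, `0, a' ∈ A 1`, `0, b ∈ B 0`, `q, q' ∈ B 1`, `0, c ∈ C 0`, `r, r' ∈ C 1`) whose
  encoded difference triple and `q`-code are covered by `reps` exists.  Soundness rests on one fact
  (`clauseB_fullCfg`): every listed clause is a literal instance of CKSU Def. 5.1 (tree `IsSTPP`), so a genuine
  configuration passes every test on its own branch; partial configurations pass by monotonicity (`clauseB_maskWith`).

References: H. Cohn, R. Kleinberg, B. Szegedy, C. Umans, FOCS 2005 (arXiv:math/0511460), Def. 5.1.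
Record: pub-omega HOME `pub-omega-eng2/results/c4red/K2-THRESHOLD-eng2.md` §NEG (ENG2 gen 17, 2026-08-23).
-/

open Literature.Computability.AlgebraicComplexity Finset

namespace Summit.MatrixMultiplication.OmegaCensus

namespace STPP222SqNeg

/-! ## 1. Codes -/

/-- A CODE STRUCTURE for a group `G`: an injective map `enc : G → C` intertwining subtraction, addition and `0` with the
code operations, and a numbering `key` of codes injective on the image (used to order the two elements of `B 1`, `C 1`). -/
structure Enc (G C : Type) [AddCommGroup G] where
  /-- the code operations -/ ops : COps C
  /-- the encoding -/ enc : G → C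
  /-- numbering of codes -/ key : C → ℕ
  /-- `enc` intertwines subtraction -/ enc_sub : ∀ x y, enc (x - y) = ops.sub (enc x) (enc y)
  /-- `enc` intertwines addition -/ enc_add : ∀ x y, enc (x + y) = ops.add (enc x) (enc y)
  /-- `enc 0` is the zero code -/ enc_zero : enc 0 = ops.zero
  /-- `enc` is injective -/ enc_inj : Function.Injective enc
  /-- `key ∘ enc` is injective -/ key_inj : Function.Injective (key ∘ enc)

/-- Code operations for `ZMod n`: arithmetic modulo `n` on `ℕ`. -/
def zmodOps (n : ℕ) : COps ℕ where
  sub x y := (x + (n - y)) % n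
  add x y := (x + y) % n
  zero := 0

/-- Componentwise code operations for a binary product. -/
def prodOps {C₁ C₂ : Type} (o₁ : COps C₁) (o₂ : COps C₂) : COps (C₁ × C₂) where
  sub x y := (o₁.sub x.1 y.1, o₂.sub x.2 y.2)
  add x y := (o₁.add x.1 y.1, o₂.add x.2 y.2)
  zero := (o₁.zero, o₂.zero)

/-- The code structure of `ZMod n` (`n ≠ 0`): `enc = ZMod.val`, `key = id`. -/
def zmodEnc (n : ℕ) [NeZero n] : Enc (ZMod n) ℕ where
  ops := zmodOps n
  enc := ZMod.val
  key := id
  enc_sub x y := by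
    show (x - y).val = (x.val + (n - y.val)) % n
    rw [sub_eq_add_neg, ZMod.val_add, ZMod.neg_val]
    by_cases h : y = 0
    · simp only [h, if_true, ZMod.val_zero, Nat.sub_zero, add_zero, Nat.add_mod_right]
    · simp only [h, if_false]
  enc_add x y := ZMod.val_add x y
  enc_zero := ZMod.val_zero
  enc_inj := ZMod.val_injective n
  key_inj := ZMod.val_injective n

/-- The code structure of a product: componentwise codes, mixed-radix key with radix `R` bounding the second code's keys. -/
def prodEnc {G₁ G₂ C₁ C₂ : Type} [AddCommGroup G₁] [AddCommGroup G₂] (E₁ : Enc G₁ C₁) (E₂ : Enc G₂ C₂) (R : ℕ)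
    (hR : ∀ y : G₂, E₂.key (E₂.enc y) < R) : Enc (G₁ × G₂) (C₁ × C₂) where
  ops := prodOps E₁.ops E₂.ops
  enc x := (E₁.enc x.1, E₂.enc x.2)
  key x := E₁.key x.1 * R + E₂.key x.2
  enc_sub x y := by simp only [Prod.fst_sub, Prod.snd_sub, prodOps, E₁.enc_sub, E₂.enc_sub]
  enc_add x y := by simp only [Prod.fst_add, Prod.snd_add, prodOps, E₁.enc_add, E₂.enc_add]
  enc_zero := by simp only [Prod.fst_zero, Prod.snd_zero, prodOps, E₁.enc_zero, E₂.enc_zero]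
  enc_inj x y h := by
    obtain ⟨h1, h2⟩ := Prod.mk.inj h
    exact Prod.ext (E₁.enc_inj h1) (E₂.enc_inj h2)
  key_inj x y h := by
    simp only [Function.comp_apply] at h
    have h2 : E₂.key (E₂.enc x.2) = E₂.key (E₂.enc y.2) := by
      have := congrArg (· % R) h; simp only [Nat.mul_add_mod_self_right, Nat.mod_eq_of_lt (hR _)] at this; exact this
    have h1 : E₁.key (E₁.enc x.1) = E₁.key (E₁.enc y.1) := by
      have hR0 : 0 < R := lt_of_le_of_lt (Nat.zero_le _) (hR x.2)
      rw [h2] at h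
      exact Nat.eq_of_mul_eq_mul_right hR0 (Nat.add_right_cancel h)
    exact Prod.ext (E₁.key_inj h1) (E₂.key_inj h2)

/-- Keys of a product code structure are below `R₁ * R` when the first factor's keys are below `R₁`. -/
theorem prodEnc_key_lt {G₁ G₂ C₁ C₂ : Type} [AddCommGroup G₁] [AddCommGroup G₂] (E₁ : Enc G₁ C₁) (E₂ : Enc G₂ C₂)
    (R : ℕ) (hR : ∀ y : G₂, E₂.key (E₂.enc y) < R) (R₁ : ℕ) (h₁ : ∀ x : G₁, E₁.key (E₁.enc x) < R₁) (y : G₁ × G₂) :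
    (prodEnc E₁ E₂ R hR).key ((prodEnc E₁ E₂ R hR).enc y) < R₁ * R := by
  show E₁.key (E₁.enc y.1) * R + E₂.key (E₂.enc y.2) < R₁ * R
  have h1 := h₁ y.1
  have h2 := hR y.2
  calc E₁.key (E₁.enc y.1) * R + E₂.key (E₂.enc y.2) < E₁.key (E₁.enc y.1) * R + R := by omega
    _ = (E₁.key (E₁.enc y.1) + 1) * R := by ring
    _ ≤ R₁ * R := Nat.mul_le_mul_right _ h1

/-- Keys of `ZMod n` codes are `< n`. -/
theorem zmodEnc_key_lt (n : ℕ) [NeZero n] (y : ZMod n) : (zmodEnc n).key ((zmodEnc n).enc y) < n := ZMod.val_lt y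

/-! ## 2. The normal-form configuration (membership form) and the reflection -/

/-- `Fin 2` index of a Boolean triple index. -/
def fi (t : Bool) : Fin 2 := bif t then 1 else 0

/-- Element `e` of `A t` in normal form. -/
def gA {G : Type} [Zero G] (a a' : G) : Bool → Bool → G
  | false, false => 0
  | false, true => a
  | true, false => 0
  | true, true => a'

/-- Element `e` of `B t` in normal form. -/
def gB {G : Type} [Zero G] (b q q' : G) : Bool → Bool → G
  | false, false => 0
  | false, true => b
  | true, false => q
  | true, true => q'

/-- Membership form of a normal-form configuration, `A`-sets: `0, a ∈ A 0` and `0, a' ∈ A 1`, read through `gA`. -/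
theorem gA_mem {G : Type} [AddCommGroup G] {A : Fin 2 → Finset G} {a a' : G} (h0 : (0 : G) ∈ A 0) (ha : a ∈ A 0)
    (h1 : (0 : G) ∈ A 1) (ha' : a' ∈ A 1) (t e : Bool) : gA a a' t e ∈ A (fi t) := by
  cases t <;> cases e <;> simp [gA, fi, h0, ha, h1, ha']

/-- Membership form of a normal-form configuration, `B`-sets (also used for `C`): `0, b ∈ B 0` and `q, q' ∈ B 1`. -/
theorem gB_mem {G : Type} [AddCommGroup G] {B : Fin 2 → Finset G} {b q q' : G} (h0 : (0 : G) ∈ B 0) (hb : b ∈ B 0)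
    (hq : q ∈ B 1) (hq' : q' ∈ B 1) (t e : Bool) : gB b q q' t e ∈ B (fi t) := by
  cases t <;> cases e <;> simp [gB, fi, h0, hb, hq, hq']

/-- Distinct entries: equal selected `A`-elements at the same triple have equal position bits. -/
theorem gA_inj {G : Type} [AddCommGroup G] {a a' : G} (ha : a ≠ 0) (ha' : a' ≠ 0) (t e₁ e₂ : Bool)
    (h : gA a a' t e₁ = gA a a' t e₂) : e₁ = e₂ := by
  cases t <;> cases e₁ <;> cases e₂ <;> simp_all [gA, eq_comm]

/-- Distinct entries: equal selected `B`-elements at the same triple have equal position bits. -/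
theorem gB_inj {G : Type} [AddCommGroup G] {b q q' : G} (hb : b ≠ 0) (hq : q ≠ q') (t e₁ e₂ : Bool)
    (h : gB b q q' t e₁ = gB b q q' t e₂) : e₁ = e₂ := by
  cases t <;> cases e₁ <;> cases e₂ <;> simp_all [gB, eq_comm]

/-- `fi` is injective. -/
theorem fi_inj {t t' : Bool} (h : fi t = fi t') : t = t' := by
  cases t <;> cases t' <;> simp_all [fi]

/-- The full code configuration of a normal-form configuration. -/
def fullCfg {G C : Type} [AddCommGroup G] (E : Enc G C) (a b c q q' r r' a' : G) : PCfg C :=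
  ⟨E.enc a, E.enc b, E.enc c, some (E.enc q), some (E.enc q'), some (E.enc r), some (E.enc r'), some (E.enc a')⟩

/-- Lookups of the full configuration are the codes of the selected elements (`A`). -/
theorem fullCfg_A {G C : Type} [AddCommGroup G] (E : Enc G C) (a b c q q' r r' a' : G) (t e : Bool) :
    (fullCfg E a b c q q' r r' a').A E.ops.zero t e = some (E.enc (gA a a' t e)) := by
  cases t <;> cases e <;> simp [fullCfg, PCfg.A, gA, E.enc_zero]

/-- Lookups of the full configuration are the codes of the selected elements (`B`). -/
theorem fullCfg_B {G C : Type} [AddCommGroup G] (E : Enc G C) (a b c q q' r r' a' : G) (t e : Bool) :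
    (fullCfg E a b c q q' r r' a').B E.ops.zero t e = some (E.enc (gB b q q' t e)) := by
  cases t <;> cases e <;> simp [fullCfg, PCfg.B, gB, E.enc_zero]

/-- Lookups of the full configuration are the codes of the selected elements (`C`). -/
theorem fullCfg_C {G C : Type} [AddCommGroup G] (E : Enc G C) (a b c q q' r r' a' : G) (t e : Bool) :
    (fullCfg E a b c q q' r r' a').C E.ops.zero t e = some (E.enc (gB c r r' t e)) := by
  cases t <;> cases e <;> simp [fullCfg, PCfg.C, gB, E.enc_zero]

/-- KEY FACT (reflection of Def. 5.1): a genuine normal-form STPP configuration with distinct entries passes EVERY clause. -/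
theorem clauseB_fullCfg {G C : Type} [AddCommGroup G] [DecidableEq G] [DecidableEq C] (E : Enc G C)
    {SA SB SC : Fin 2 → Finset G} {a b c q q' r r' a' : G} (ha : a ≠ 0) (ha' : a' ≠ 0) (hb : b ≠ 0) (hq : q ≠ q')
    (hc : c ≠ 0) (hr : r ≠ r') (hA0 : (0 : G) ∈ SA 0) (haA : a ∈ SA 0) (hA1 : (0 : G) ∈ SA 1) (haA' : a' ∈ SA 1)
    (hB0 : (0 : G) ∈ SB 0) (hbB : b ∈ SB 0) (hqB : q ∈ SB 1) (hqB' : q' ∈ SB 1) (hC0 : (0 : G) ∈ SC 0) (hcC : c ∈ SC 0)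
    (hrC : r ∈ SC 1) (hrC' : r' ∈ SC 1) (hS : IsSTPP SA SB SC) (ι : Idx) :
    clauseB E.ops (fullCfg E a b c q q' r r' a') ι = true := by
  have hw : (fullCfg E a b c q q' r r' a').word E.ops ι =
      some (E.enc ((gA a a' ι.i ι.es' - gA a a' ι.k ι.es) + (gB b q q' ι.j ι.et' - gB b q q' ι.i ι.et) +
        (gB c r r' ι.k ι.eu' - gB c r r' ι.j ι.eu))) := by
    simp only [PCfg.word, fullCfg_A, fullCfg_B, fullCfg_C, wordOpt, Option.bind_some, E.enc_add, E.enc_sub]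
  unfold clauseB
  rw [hw]
  simp only [Bool.or_eq_true, Bool.not_eq_true', beq_eq_false_iff_ne, ne_eq]
  by_cases h0 : (gA a a' ι.i ι.es' - gA a a' ι.k ι.es) + (gB b q q' ι.j ι.et' - gB b q q' ι.i ι.et) +
      (gB c r r' ι.k ι.eu' - gB c r r' ι.j ι.eu) = 0
  · right
    obtain ⟨hij, hjk, hs, ht, hu⟩ := hS (fi ι.i) (fi ι.j) (fi ι.k) _ (gA_mem hA0 haA hA1 haA' ι.k ι.es)
      _ (gA_mem hA0 haA hA1 haA' ι.i ι.es') _ (gB_mem hB0 hbB hqB hqB' ι.i ι.et) _ (gB_mem hB0 hbB hqB hqB' ι.j ι.et')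
      _ (gB_mem hC0 hcC hrC hrC' ι.j ι.eu) _ (gB_mem hC0 hcC hrC hrC' ι.k ι.eu') h0
    have hij' := fi_inj hij
    have hjk' := fi_inj hjk
    have e1 : ι.es = ι.es' := gA_inj ha ha' _ _ _ (by rw [← hjk', ← hij'] at hs; exact hs)
    have e2 : ι.et = ι.et' := gB_inj hb hq _ _ _ (by rw [← hij'] at ht; exact ht)
    have e3 : ι.eu = ι.eu' := gB_inj hc hr _ _ _ (by rw [← hjk'] at hu; exact hu)
    simp [Idx.concl, hij', hjk', e1, e2, e3]
  · left
    intro h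
    exact h0 (E.enc_inj (h.trans E.enc_zero.symm))

/-- An unassigned first entry makes the word unassigned. -/
theorem wordOpt_none₁ {C : Type} (o : COps C) (s' t t' u u' : Option C) : wordOpt o none s' t t' u u' = none := rfl

/-- An unassigned second entry makes the word unassigned. -/
theorem wordOpt_none₂ {C : Type} (o : COps C) (s t t' u u' : Option C) : wordOpt o s none t t' u u' = none := by
  cases s <;> rfl

/-- An unassigned third entry makes the word unassigned. -/
theorem wordOpt_none₃ {C : Type} (o : COps C) (s s' t' u u' : Option C) : wordOpt o s s' none t' u u' = none := by
  cases s <;> cases s' <;> rfl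

/-- An unassigned fourth entry makes the word unassigned. -/
theorem wordOpt_none₄ {C : Type} (o : COps C) (s s' t u u' : Option C) : wordOpt o s s' t none u u' = none := by
  cases s <;> cases s' <;> cases t <;> rfl

/-- An unassigned fifth entry makes the word unassigned. -/
theorem wordOpt_none₅ {C : Type} (o : COps C) (s s' t t' u' : Option C) : wordOpt o s s' t t' none u' = none := by
  cases s <;> cases s' <;> cases t <;> cases t' <;> rfl

/-- An unassigned sixth entry makes the word unassigned. -/
theorem wordOpt_none₆ {C : Type} (o : COps C) (s s' t t' u : Option C) : wordOpt o s s' t t' u none = none := by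
  cases s <;> cases s' <;> cases t <;> cases t' <;> cases u <;> rfl

/-- The word is monotone in assignedness: with each optional entry either unassigned or equal, the word of the smaller
configuration is `none` or the same. -/
theorem wordOpt_mono {C : Type} (o : COps C) {s₁ s'₁ t₁ t'₁ u₁ u'₁ s₂ s'₂ t₂ t'₂ u₂ u'₂ : Option C}
    (h1 : s₁ = none ∨ s₁ = s₂) (h2 : s'₁ = none ∨ s'₁ = s'₂) (h3 : t₁ = none ∨ t₁ = t₂) (h4 : t'₁ = none ∨ t'₁ = t'₂)
    (h5 : u₁ = none ∨ u₁ = u₂) (h6 : u'₁ = none ∨ u'₁ = u'₂) :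
    wordOpt o s₁ s'₁ t₁ t'₁ u₁ u'₁ = none ∨ wordOpt o s₁ s'₁ t₁ t'₁ u₁ u'₁ = wordOpt o s₂ s'₂ t₂ t'₂ u₂ u'₂ := by
  rcases h1 with h1 | h1
  · left; rw [h1]; exact wordOpt_none₁ o _ _ _ _ _
  rcases h2 with h2 | h2
  · left; rw [h2]; exact wordOpt_none₂ o _ _ _ _ _
  rcases h3 with h3 | h3
  · left; rw [h3]; exact wordOpt_none₃ o _ _ _ _ _
  rcases h4 with h4 | h4
  · left; rw [h4]; exact wordOpt_none₄ o _ _ _ _ _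
  rcases h5 with h5 | h5
  · left; rw [h5]; exact wordOpt_none₅ o _ _ _ _ _
  rcases h6 with h6 | h6
  · left; rw [h6]; exact wordOpt_none₆ o _ _ _ _ _
  right; rw [h1, h2, h3, h4, h5, h6]

/-- The partial configuration obtained from `F` by keeping the optional entries flagged `true` and unassigning the rest. -/
def PCfg.maskWith {C : Type} (F : PCfg C) (mq mr mq' mr' ma' : Bool) : PCfg C :=
  ⟨F.a, F.b, F.c, bif mq then F.q else none, bif mq' then F.q' else none, bif mr then F.r else none,
    bif mr' then F.r' else none, bif ma' then F.a' else none⟩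

/-- Lookups of a masked configuration are unassigned or those of `F` (`A`). -/
theorem PCfg.maskWith_A {C : Type} (F : PCfg C) (mq mr mq' mr' ma' : Bool) (z : C) (t e : Bool) :
    (F.maskWith mq mr mq' mr' ma').A z t e = none ∨ (F.maskWith mq mr mq' mr' ma').A z t e = F.A z t e := by
  cases t <;> cases e <;> cases ma' <;> simp [PCfg.A, PCfg.maskWith]

/-- Lookups of a masked configuration are unassigned or those of `F` (`B`). -/
theorem PCfg.maskWith_B {C : Type} (F : PCfg C) (mq mr mq' mr' ma' : Bool) (z : C) (t e : Bool) :
    (F.maskWith mq mr mq' mr' ma').B z t e = none ∨ (F.maskWith mq mr mq' mr' ma').B z t e = F.B z t e := by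
  cases t <;> cases e <;> cases mq <;> cases mq' <;> simp [PCfg.B, PCfg.maskWith]

/-- Lookups of a masked configuration are unassigned or those of `F` (`C`). -/
theorem PCfg.maskWith_C {C : Type} (F : PCfg C) (mq mr mq' mr' ma' : Bool) (z : C) (t e : Bool) :
    (F.maskWith mq mr mq' mr' ma').C z t e = none ∨ (F.maskWith mq mr mq' mr' ma').C z t e = F.C z t e := by
  cases t <;> cases e <;> cases mr <;> cases mr' <;> simp [PCfg.C, PCfg.maskWith]

/-- Monotonicity: a clause that holds on `F` holds on every masked configuration. -/
theorem clauseB_maskWith {C : Type} [DecidableEq C] (o : COps C) (F : PCfg C) (mq mr mq' mr' ma' : Bool) (ι : Idx)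
    (hF : clauseB o F ι = true) : clauseB o (F.maskWith mq mr mq' mr' ma') ι = true := by
  have hm := wordOpt_mono o (F.maskWith_A mq mr mq' mr' ma' o.zero ι.k ι.es)
    (F.maskWith_A mq mr mq' mr' ma' o.zero ι.i ι.es') (F.maskWith_B mq mr mq' mr' ma' o.zero ι.i ι.et)
    (F.maskWith_B mq mr mq' mr' ma' o.zero ι.j ι.et') (F.maskWith_C mq mr mq' mr' ma' o.zero ι.j ι.eu)
    (F.maskWith_C mq mr mq' mr' ma' o.zero ι.k ι.eu')
  unfold clauseB at hF ⊢
  change (match (F.maskWith mq mr mq' mr' ma').word o ι with | none => true | some w => !(w == o.zero) || ι.concl) = true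
  rcases hm with hm | hm
  · rw [show (F.maskWith mq mr mq' mr' ma').word o ι = none from hm]
  · rw [show (F.maskWith mq mr mq' mr' ma').word o ι = F.word o ι from hm]; exact hF

/-- Monotonicity for clause lists. -/
theorem levelB_maskWith {C : Type} [DecidableEq C] (o : COps C) (F : PCfg C) (mq mr mq' mr' ma' : Bool)
    (L : List Idx) (hF : ∀ ι, clauseB o F ι = true) : levelB o (F.maskWith mq mr mq' mr' ma') L = true := by
  simp only [levelB, List.all_eq_true]
  exact fun ι _ => clauseB_maskWith o F mq mr mq' mr' ma' ι (hF ι)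

/-- REFLECTION THEOREM.  If the kernel search over the start list `reps` returns `true`, then there is no STPP
configuration over `G` in normal form — `0, a ∈ A 0`, `0, a' ∈ A 1`, `0, b ∈ B 0`, `q, q' ∈ B 1`, `0, c ∈ C 0`, `r, r' ∈ C 1`
with `a, a', b, c ≠ 0` and `q, q'` resp. `r, r'` in increasing key order — whose encoded difference triple `(a, b, c)` together
with the code of `q` is covered by `reps`. [cite: CohnKleinbergSzegedyUmans2005, Def. 5.1] -/
theorem nf_false_of_searchB {G C : Type} [AddCommGroup G] [DecidableEq G] [DecidableEq C] (E : Enc G C)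
    {el : List C} (hel : ∀ x : G, E.enc x ∈ el) {reps : List (C × C × C × List C)}
    (hs : searchB E.ops el E.key reps = true) {SA SB SC : Fin 2 → Finset G}
    {a b c q q' r r' a' : G} (ha : a ≠ 0) (ha' : a' ≠ 0) (hb : b ≠ 0) (hc : c ≠ 0)
    (hq : E.key (E.enc q) < E.key (E.enc q')) (hr : E.key (E.enc r) < E.key (E.enc r'))
    (hA0 : (0 : G) ∈ SA 0) (haA : a ∈ SA 0) (hA1 : (0 : G) ∈ SA 1) (haA' : a' ∈ SA 1)
    (hB0 : (0 : G) ∈ SB 0) (hbB : b ∈ SB 0) (hqB : q ∈ SB 1) (hqB' : q' ∈ SB 1) (hC0 : (0 : G) ∈ SC 0) (hcC : c ∈ SC 0)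
    (hrC : r ∈ SC 1) (hrC' : r' ∈ SC 1)
    {qs : List C} (hrep : (E.enc a, E.enc b, E.enc c, qs) ∈ reps) (hqs : E.enc q ∈ qs)
    (hS : IsSTPP SA SB SC) : False := by
  have hqne : q ≠ q' := fun h => by subst h; exact lt_irrefl _ hq
  have hrne : r ≠ r' := fun h => by subst h; exact lt_irrefl _ hr
  have hF := clauseB_fullCfg E ha ha' hb hqne hc hrne hA0 haA hA1 haA' hB0 hbB hqB hqB' hC0 hcC hrC hrC' hS
  have lev : ∀ (mq mr mq' mr' ma' : Bool) (L : List Idx),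
      levelB E.ops ((fullCfg E a b c q q' r r' a').maskWith mq mr mq' mr' ma') L = true :=
    fun mq mr mq' mr' ma' L => levelB_maskWith E.ops _ mq mr mq' mr' ma' L hF
  have bq : Nat.blt (E.key (E.enc q)) (E.key (E.enc q')) = true := by simp [Nat.blt_eq, hq]
  have br : Nat.blt (E.key (E.enc r)) (E.key (E.enc r')) = true := by simp [Nat.blt_eq, hr]
  have ne_of_false : ∀ {x : Bool}, x = false → ¬ x = true := fun h => by rw [h]; exact Bool.false_ne_true
  -- walk down the genuine branch
  unfold searchB at hs
  have h0 := List.all_eq_true.1 hs _ hrep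
  simp only [Bool.or_eq_true, Bool.not_eq_true'] at h0
  rcases h0 with h0 | h1
  · exact ne_of_false h0 (lev false false false false false L0)
  unfold lv1 at h1
  have h1 := List.all_eq_true.1 h1 _ hqs
  simp only [Bool.or_eq_true, Bool.not_eq_true'] at h1
  rcases h1 with h1 | h2
  · exact ne_of_false h1 (lev true false false false false L1)
  unfold lv2 at h2
  have h2 := List.all_eq_true.1 h2 _ (hel r)
  simp only [Bool.or_eq_true, Bool.not_eq_true'] at h2
  rcases h2 with h2 | h3
  · exact ne_of_false h2 (lev true true false false false L2)
  unfold lv3 at h3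
  have h3 := List.all_eq_true.1 h3 _ (hel q')
  simp only [Bool.or_eq_true, Bool.not_eq_true', bq] at h3
  rcases h3 with (h3 | h3) | h4
  · exact Bool.noConfusion h3
  · exact ne_of_false h3 (lev true true true false false L3)
  unfold lv4 at h4
  have h4 := List.all_eq_true.1 h4 _ (hel r')
  simp only [Bool.or_eq_true, Bool.not_eq_true', br] at h4
  rcases h4 with (h4 | h4) | h5
  · exact Bool.noConfusion h4
  · exact ne_of_false h4 (lev true true true true false L4)
  unfold lv5 at h5
  have h5 := List.all_eq_true.1 h5 _ (hel a')
  simp only [Bool.not_eq_true'] at h5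
  exact ne_of_false h5 (lev true true true true true L5)

end STPP222SqNeg

end Summit.MatrixMultiplication.OmegaCensus
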